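import Literature.AnabelianGeometry.EtaleTheta.Discharge.Sec5Thm57FinalKnitV6OfThetaSettingNonDilating
import Literature.AnabelianGeometry.EtaleTheta.Discharge.Sec5Thm57KummerTorsionOfEtaleTower

/-!
# [EtTh] §5, Theorem 5.7 — FINAL KNIT v6 AT THE TOWER OF THE SETTING, canonical monoid vocabularies («`Φ` non-dilating» DISCHARGED),
# WITH THE (C) RESIDUAL `htorsfam` SUPPLIED BY THE ÉTALE SIDE (constant-multiple rigidity on the tower, translation-freeness, separation
# across levels, the pins and Thm. 5.6 at each member) (pp. 324–331, 291, 268 / PDF pp. 98–105, 65, 42)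

Mochizuki, *The étale theta function and its Frobenioid-theoretic manifestations*, Publ. RIMS **45** (2009)
[cite: MochizukiEtTh2009, Thm 5.7 p.329–330 (PDF pp.103–104); Thm 5.6 p.328 (PDF p.102); Prop 5.2 (iii) p.324 (PDF p.98); Cor 2.19 (iii)
p.291 (PDF p.65); Cor 2.8 (i) p.268 (PDF p.42); Lem 5.8 p.331 (PDF p.105); Prop 3.2 (iii) p.296 (PDF p.70); Cor 2.18 (i) p.285–286
(PDF pp.59–60); Prop 5.1 p.323 (PDF p.97)].  abc-iut cell, layer L2, node `EtTh:Thm5.7`; abc-iut-L2-lead (gen 6) R798/R808 «(e3) COMPOSE»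
(seat abc-iut-w6-d049 gen 5), the NonDilating twins of `Sec5Thm57FinalKnitV6OfThetaSettingOfEtale.lean` (p480505).  PROOF-ONLY (0 definitions,
0 new named facts; nothing landed is edited or restated): ONE application of abc-iut-f-123's (e1) twin
`thetaRootPreservedAll_ofThetaSettingYddFamily_final_v6_treeMonoidVocab_of_cor218_i`
(`Sec5Thm57FinalKnitV6OfThetaSettingNonDilating.lean`) with the (C) binder `htorsfam` := this seat's `ThetaFrobenioidTower.kummerTorsion_of_etaleTower`
(p478416; route p473560 → p476411 → p473372) member by member — exactly the substitution of p480505, now over the canonical tree monoid vocabulary `treeMonoidVocab`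
(no `hnd`).

WHAT CHANGES vs (e1).  `htorsfam` GONE; displayed instead (all but the last independent of the family members): the §5 ↔ §2 dictionary at every
level `M ∈ Es` (`ι`, `hι`, `m_M`, abc-iut-L2-t4's `CyclotomicCharacterCompat`, the §5 `Facts`, the pins `ThetaSectionCompat` of a COMPATIBLE family
`η`); the étale data on `Cu.thetaEnvTower τ hC hS` (`(γ, γ_μ)` with `hstd` = VERBATIM the conclusion shape of abc-iut-L2-t2's FACT
`MuTwoSetting.Cor219_iii_std`, F-0652, at `l := T.l`; glue `hγμχ`/`hγμred`/`haug`; translation-freeness in pure étale currency `hinfη`; separation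
across levels `hsep`); and `hK4fam` — Thm. 5.6 at each family member (base shadow with its laws, (K4m) at `γ_μ`), quantified exactly like `htorsfam`.
RESULT `thetaRootPreservedAll_ofThetaSettingYddFamily_final_v6_treeMonoidVocab_of_cor219iiiStd` (the weak-vocabulary twin is the sibling file
`Sec5Thm57FinalKnitV6OfThetaSettingNonDilatingWeakOfEtale.lean`).
HONEST FRAMING: kernel-checked composition of landed theorems for data so parametrised (no instance of the class `TemperedFrobenioid T₀
(ConnectedPart (BTemp Π^tp_X̲̲)) VD` for an actual curve is constructed anywhere in the tree); none of the displayed binders is discharged here;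
F-0620 / `Prop15iii` / the F-0652 SHAPE are FACT-policy labels or named residuals (nothing of [EtTh] is asserted unconditionally); typed ≠
discharged — PROVED modulo the displayed binders; no side taken on anything downstream ([IUTchIII] Cor. 3.12 in particular).
-/

noncomputable section

namespace Literature.AnabelianGeometry.EtaleTheta

open CategoryTheory Opposite Literature.AlgebraicGeometry.Frobenioids Literature.AnabelianGeometry.SemiGraphs
  Literature.AnabelianGeometry.SemiGraphs.GaloisObjects

universe v₀ u₁ v₁

namespace ThetaFrobenioidTower

section CanonicalV6E

variable {p : ℕ} [Fact p.Prime] {DS : ThetaSetting p} {ES : DS.EtaleThetaData} {l' : ℕ} (Cu : ES.DoubleUnderline l')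
  {e' : DS.toTemperedCurve.GroupLevelData} {Es : Set ℕ+} (τ : DS.CyclotomeTower l' Es) (hC : DS.Compat) (hS : DS.Sec2Hyps)
  {D₀ : Type} [Category.{v₀} D₀] {T₀ : RealifiedDivisorMonoids (D₀ := D₀) treeMonoidVocab.{0}}
  {VD : FrdICatStub.{1, 0, 0} (ConnectedPart (BTemp (Cu.temperedArithmeticGroup e').Pi))}
  {tf : TemperedFrobenioid T₀ (ConnectedPart (BTemp (Cu.temperedArithmeticGroup e').Pi)) VD} {hZ : tf.monoidType = MonoidType.Z}
  {hP : ∀ A : (ConnectedPart (BTemp (Cu.temperedArithmeticGroup e').Pi))ᵒᵖ, IsPerfect (tf.Φ.carrier A)}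
  {NH : Subgroup (Field.absoluteGaloisGroup DS.K) → tf.category → ℕ+ → Prop}
  {pullFrac : ∀ {A A' : (BiKummerSetting.mkOfConnectedTemperoidYddTower (Cu.temperedArithmeticGroup e') tf hZ hP NH (Cu.thetaEnvTower τ hC hS)
    (ContinuousMulEquiv.refl _)).C} (_ : A' ⟶ A), (BiKummerSetting.mkOfConnectedTemperoidYddTower (Cu.temperedArithmeticGroup e') tf hZ hP NH
    (Cu.thetaEnvTower τ hC hS) (ContinuousMulEquiv.refl _)).biratUnits A → (BiKummerSetting.mkOfConnectedTemperoidYddTower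
    (Cu.temperedArithmeticGroup e') tf hZ hP NH (Cu.thetaEnvTower τ hC hS) (ContinuousMulEquiv.refl _)).biratUnits A'}
  {θ : (BiKummerSetting.mkOfConnectedTemperoidYddTower (Cu.temperedArithmeticGroup e') tf hZ hP NH (Cu.thetaEnvTower τ hC hS)
    (ContinuousMulEquiv.refl _)).biratUnits (BiKummerSetting.mkOfConnectedTemperoidYddTower (Cu.temperedArithmeticGroup e') tf hZ hP NH
    (Cu.thetaEnvTower τ hC hS) (ContinuousMulEquiv.refl _)).Aodot}
  {Bl : (BiKummerSetting.mkOfConnectedTemperoidYddTower (Cu.temperedArithmeticGroup e') tf hZ hP NH (Cu.thetaEnvTower τ hC hS)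
    (ContinuousMulEquiv.refl _)).C}
  {Pl : (BiKummerSetting.mkOfConnectedTemperoidYddTower (Cu.temperedArithmeticGroup e') tf hZ hP NH (Cu.thetaEnvTower τ hC hS)
    (ContinuousMulEquiv.refl _)).FractionPair θ Bl}
  {Rl : (BiKummerSetting.mkOfConnectedTemperoidYddTower (Cu.temperedArithmeticGroup e') tf hZ hP NH (Cu.thetaEnvTower τ hC hS)
    (ContinuousMulEquiv.refl _)).NthRoot θ Pl Cu.lPNat pullFrac}
  (h : ModelFrobenioid.Hypotheses tf.divisorMonoid tf.ratFnFunctor)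
  (Q : FrobenioidTheta.ThetaSubquotientStub.{0} (ConnectedPart (BTemp (Cu.temperedArithmeticGroup e').Pi)))
  (R : ∀ N : ℕ+, (BiKummerSetting.mkOfConnectedTemperoidYddTower (Cu.temperedArithmeticGroup e') tf hZ hP NH (Cu.thetaEnvTower τ hC hS)
    (ContinuousMulEquiv.refl _)).NthRoot Rl.root Rl.pair N pullFrac)
  (K' : Type) [Field K'] {X₀ : ConnectedPart (BTemp (Cu.temperedArithmeticGroup e').Pi)}
  (hX₀ : ∀ Y : ConnectedPart (BTemp (Cu.temperedArithmeticGroup e').Pi), Subsingleton (Y ⟶ X₀))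
  (t : ∀ N : ℕ+, (R N).BN.base ⟶ X₀) (c₀ : K'ˣ →* (tf.ratFnFunctor.obj (op X₀))ˣ)
  (hc₀ : Function.Injective c₀) (ht : ∀ N : ℕ+, Function.Injective (tf.ratFnFunctor.map (t N).op).hom)
  (hinvc : ∀ (N : ℕ+) (g : Aut (R N).AN.base), pull tf.divisorMonoid g.hom (ModelFrobenioid.div (R N).pair.num) = ModelFrobenioid.div (R
    N).pair.num)
  (hinvp : ∀ (N : ℕ+) (y : (Cu.thetaEnvTower τ hC hS).PiX), y ∈ (Cu.thetaEnvTower τ hC hS).PiYdd → pull tf.divisorMonoid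
    ((BiKummerSetting.mkOfConnectedTemperoidYddTower (Cu.temperedArithmeticGroup e') tf hZ hP NH (Cu.thetaEnvTower τ hC hS) (ContinuousMulEquiv.refl
    _)).galoisSurj (R N).AN.base (R N).αData.isGalois ((ContinuousMulEquiv.refl _) y)).hom (ModelFrobenioid.div (R N).pair.den) =
    ModelFrobenioid.div (R N).pair.den)
  (α : ∀ {N N' : ℕ+}, (N : ℕ) ∣ N' → ((R N').AN ⟶ (R N).AN))
  (β : ∀ {N N' : ℕ+}, (N : ℕ) ∣ N' → ((R N').BN ⟶ (R N).BN))
  (comm_sCap : ∀ {N N' : ℕ+} (hd : (N : ℕ) ∣ N'), (R N').pair.num ≫ β hd = α hd ≫ (R N).pair.num)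
  (comm_sCup : ∀ {N N' : ℕ+} (hd : (N : ℕ) ∣ N'), (R N').pair.den ≫ β hd = α hd ≫ (R N).pair.den)
  (isIsometry_α : ∀ {N N' : ℕ+} (hd : (N : ℕ) ∣ N'), ((BiKummerSetting.mkOfConnectedTemperoidYddTower (Cu.temperedArithmeticGroup e') tf hZ hP NH
    (Cu.thetaEnvTower τ hC hS) (ContinuousMulEquiv.refl _)).sec5Stub h).pre.IsIsometry (α hd))
  (degFr_α : ∀ {N N' : ℕ+} (hd : (N : ℕ) ∣ N'), (((BiKummerSetting.mkOfConnectedTemperoidYddTower (Cu.temperedArithmeticGroup e') tf hZ hP NH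
    (Cu.thetaEnvTower τ hC hS) (ContinuousMulEquiv.refl _)).sec5Stub h).pre.degFr (α hd) : ℕ) * N = N')
  (isIsometry_β : ∀ {N N' : ℕ+} (hd : (N : ℕ) ∣ N'), ((BiKummerSetting.mkOfConnectedTemperoidYddTower (Cu.temperedArithmeticGroup e') tf hZ hP NH
    (Cu.thetaEnvTower τ hC hS) (ContinuousMulEquiv.refl _)).sec5Stub h).pre.IsIsometry (β hd))
  (degFr_β : ∀ {N N' : ℕ+} (hd : (N : ℕ) ∣ N'), (((BiKummerSetting.mkOfConnectedTemperoidYddTower (Cu.temperedArithmeticGroup e') tf hZ hP NH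
    (Cu.thetaEnvTower τ hC hS) (ContinuousMulEquiv.refl _)).sec5Stub h).pre.degFr (β hd) : ℕ) * N = N')
  (baseFrob_α : ∀ {N N' : ℕ+} (hd : (N : ℕ) ∣ N'), (BiKummerSetting.mkOfConnectedTemperoidYddTower (Cu.temperedArithmeticGroup e') tf hZ hP NH
    (Cu.thetaEnvTower τ hC hS) (ContinuousMulEquiv.refl _)).IsOfBaseFrobeniusType (α hd))
  (h44 : BiKummerSetting.Thm44Hyp (BiKummerSetting.mkOfConnectedTemperoidYddTower (Cu.temperedArithmeticGroup e') tf hZ hP NH (Cu.thetaEnvTower τ hC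
    hS) (ContinuousMulEquiv.refl _)) (BiKummerSetting.mkOfConnectedTemperoidYddTower (Cu.temperedArithmeticGroup e') tf hZ hP NH (Cu.thetaEnvTower τ
    hC hS) (ContinuousMulEquiv.refl _)))
  (ψ : ∀ A : (BiKummerSetting.mkOfConnectedTemperoidYddTower (Cu.temperedArithmeticGroup e') tf hZ hP NH (Cu.thetaEnvTower τ hC hS)
    (ContinuousMulEquiv.refl _)).C, (BiKummerSetting.mkOfConnectedTemperoidYddTower (Cu.temperedArithmeticGroup e') tf hZ hP NH (Cu.thetaEnvTower τ
    hC hS) (ContinuousMulEquiv.refl _)).biratUnits A ≃* (BiKummerSetting.mkOfConnectedTemperoidYddTower (Cu.temperedArithmeticGroup e') tf hZ hP NH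
    (Cu.thetaEnvTower τ hC hS) (ContinuousMulEquiv.refl _)).biratUnits (h44.Ψ.functor.obj A))
  (hpull : ∀ {A A' : (BiKummerSetting.mkOfConnectedTemperoidYddTower (Cu.temperedArithmeticGroup e') tf hZ hP NH (Cu.thetaEnvTower τ hC hS)
    (ContinuousMulEquiv.refl _)).C} (φ : A' ⟶ A) (f : (BiKummerSetting.mkOfConnectedTemperoidYddTower (Cu.temperedArithmeticGroup e') tf hZ hP NH
    (Cu.thetaEnvTower τ hC hS) (ContinuousMulEquiv.refl _)).biratUnits A), ψ A' (pullFrac φ f) = pullFrac (h44.Ψ.functor.map φ) (ψ A f))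
  (hii : BiKummerSetting.Thm44_ii h44 ψ) (h3 : h44.PreservesFrobeniusStructure) (h4b : h44.PreservesBaseFrobeniusTypeData)
  (h8 : h44.PreservesAmple) (h15a : h44.PreservesFixedByHA ψ) (h15 : h44.PreservesSaturated ψ)
  (D : ∀ N : ℕ+, (BiKummerSetting.mkOfConnectedTemperoidYddTower (Cu.temperedArithmeticGroup e') tf hZ hP NH (Cu.thetaEnvTower τ hC hS)
    (ContinuousMulEquiv.refl _)).BaseFrobeniusTypeData (α (one_dvd_level N)))

include hX₀ h hc₀ ht comm_sCap comm_sCup isIsometry_α degFr_α isIsometry_β degFr_β hpull hii h3 h4b h8 h15a h15 D in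
/-- **[EtTh] Theorem 5.7 — FINAL KNIT v6 (root side) at the tower OF THE SETTING, canonical monoid vocabulary `treeMonoidVocab`, (C) supplied by the étale
side** — abc-iut-f-123's (e1) twin of the same name `…_of_cor218_i` with `htorsfam :=` this seat's `kummerTorsion_of_etaleTower`
(p478416) member by member; see the module docstring for the binder census.
[cite: MochizukiEtTh2009, Thm 5.7 p.329–330 (PDF pp.103–104); Thm 5.6 p.328 (PDF p.102); Cor 2.19 (iii) p.291 (PDF p.65); Prop 5.1 p.323 (PDF p.97)] -/
theorem thetaRootPreservedAll_ofThetaSettingYddFamily_final_v6_treeMonoidVocab_of_cor219iiiStd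
    (T : ThetaFrobenioidTower.{0} (BiKummerSetting.mkOfConnectedTemperoidYddTower (Cu.temperedArithmeticGroup e') tf hZ hP NH (Cu.thetaEnvTower τ hC
      hS) (ContinuousMulEquiv.refl _)).C (ConnectedPart (BTemp (Cu.temperedArithmeticGroup e').Pi)))
    (hT : T = ofThetaSettingFamily τ hC hS h Q R K' (fun N => (Units.map (tf.ratFnFunctor.map (t N).op).hom).comp c₀) (fun N =>
      tf.unitsMap_comp_injective (t N) hc₀ (ht N)) hinvc hinvp α β comm_sCap comm_sCup isIsometry_α degFr_α isIsometry_β degFr_β baseFrob_α)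
    -- (A) Lemma 5.8's geometric connectedness at EVERY level `N`: «a unit of `B_N` commuting with `s^⊓-gp_N(Im Π^tp_Y̲)` is a constant»
    -- (displayed; its level-1 instance is what v1–v5 discharged from the ONE `ConstantsDictionary` junction binder)
    (hgc : ∀ (N : ℕ+) (u : (T.atLevel N).units (T.BN N)),
      (∀ y ∈ (T.atLevel N).imPiY, T.sgpCap N y * (u : Aut (T.BN N)) * (T.sgpCap N y)⁻¹ = u) →
        (T.atLevel N).unitsToBirat (T.BN N) u ∈ (T.constEmb N).range)
    {Dcnst : Type u₁} [Category.{v₁} Dcnst] (cnst : D₀ ⥤ Dcnst)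
    (G : ConnectedPart (BTemp (Field.absoluteGaloisGroup DS.K)) ⥤ Dcnst)
    (ecn : tf.base ⋙ cnst ≅ QuasiTemperoid.pushforward (Cu.temperedArithmeticGroup e').aug.toMonoidHom (Cu.temperedArithmeticGroup
      e').aug_surjective (Cu.temperedArithmeticGroup e').augIsOpenMap_holds ⋙ G)
    (hP34 : RealifiedDivisorMonoids.Prop34Cnst T₀ cnst)
    (hF : ∀ {B B' : (BiKummerSetting.mkOfConnectedTemperoidYddTower (Cu.temperedArithmeticGroup e') tf hZ hP NH (Cu.thetaEnvTower τ hC hS)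
      (ContinuousMulEquiv.refl _)).C} (φ : B' ⟶ B) (y : (BiKummerSetting.mkOfConnectedTemperoidYddTower (Cu.temperedArithmeticGroup e') tf hZ hP NH
      (Cu.thetaEnvTower τ hC hS) (ContinuousMulEquiv.refl _)).biratUnits B), pullFrac φ y = tf.pullFracModel φ y)
    (hαover : ∀ N : ℕ+, α (one_dvd_level N) ≫ (R 1).α = (R N).α)
    (hcharAN : ∀ N : ℕ+, IsTopCharacteristic (Cu.temperedArithmeticGroup e').Pi (galoisSurjOf (Cu.temperedArithmeticGroup e').isTempered (R
      N).AN.base.obj (R N).αData.isGalois).ker)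
    (hdivA : ∀ αA : h44.Ψ.functor.obj (T.AN 1) ≅ T.AN 1, ∃ ε : Aut (T.AN 1), T.pre.div (αA.inv ≫ h44.Ψ.functor.map (T.sCap 1)) = T.pre.div (ε.hom ≫
      T.sCap 1) ∧ T.pre.div (αA.inv ≫ h44.Ψ.functor.map (T.sCup 1)) = T.pre.div (ε.hom ≫ T.sCup 1))
    {N' : ℕ+} (μ' : DS.CyclotomeMod l' N') (h15iii : DS.Prop15iii ES hC) (L : Cu.CuspLabels)
    (h218i : (Cu.rigidData μ' hC hS h15iii L).Cor218_i)
    (hL : ∀ (A'' : (BiKummerSetting.mkOfConnectedTemperoidYddTower (Cu.temperedArithmeticGroup e') tf hZ hP NH (Cu.thetaEnvTower τ hC hS)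
      (ContinuousMulEquiv.refl _)).C) (N : ℕ+) (g : A''.base ⟶ (R 1).AN.base) (ξ : tf.ratFnFunctor.obj (op (R 1).AN.base)),
      (BiKummerSetting.mkOfConnectedTemperoidYddTower (Cu.temperedArithmeticGroup e') tf hZ hP NH (Cu.thetaEnvTower τ hC hS)
      (ContinuousMulEquiv.refl _)).IsFrobeniusTrivial A'' → (BiKummerSetting.mkOfConnectedTemperoidYddTower (Cu.temperedArithmeticGroup e') tf hZ
      hP NH (Cu.thetaEnvTower τ hC hS) (ContinuousMulEquiv.refl _)).IsNHSaturatedBsFld (BiKummerSetting.mkOfConnectedTemperoidYddTower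
      (Cu.temperedArithmeticGroup e') tf hZ hP NH (Cu.thetaEnvTower τ hC hS) (ContinuousMulEquiv.refl _)).HodotBsFld A'' N →
      divB tf.divisorMonoid tf.ratFnFunctor tf.divBNatTrans (op (R 1).AN.base) ξ = 1 → ∃ ζ : tf.ratFnFunctor.obj (op A''.base), ζ ^ (N : ℕ) =
      pull tf.ratFnFunctor g ξ)
    (h58N : ∀ (N : ℕ+) (c : K'ˣ), ∃ r : tf.biratUnitsModel (R N).BN,
      (r : tf.ratFnFunctor.obj (op (R N).BN.base)) ^ (N : ℕ) = (tf.ratFnFunctor.map (t N).op).hom (c₀ c : tf.ratFnFunctor.obj (op X₀)))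
    -- (C) SUPPLIED BY THE ÉTALE SIDE (abc-iut-w6-d049 p478416): `⋂_N (K^×)^N = 1` (Prop 3.2 (iii)) stays displayed …
    (hK : ∀ x : T.Kˣ, (∀ N : ℕ+, ∃ d : T.Kˣ, d ^ (N : ℕ) = x) → x = 1)
    -- … the §5 ↔ §2 dictionary at every level `M ∈ Es` of the tower of the Setting (pins of a COMPATIBLE family `η`) …
    (ι : T.PiX ≃* (Cu.thetaEnvTower τ hC hS).PiX) (hι : ∀ y : T.PiX, y ∈ T.PiYdd ↔ ι y ∈ (Cu.thetaEnvTower τ hC hS).PiYdd)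
    (m : ∀ M : Es, (T.atLevel M).muTorsion (T.atLevel M).BN (T.atLevel M).N ≃* ((Cu.thetaEnvTower τ hC hS).level M).mu)
    (hχ : ∀ M : Es, (T.atLevel M).CyclotomicCharacterCompat ((Cu.thetaEnvTower τ hC hS).level M) ι (m M))
    (HF : ∀ M : Es, (T.atLevel M).Facts)
    (η : ∀ M : Es, (Cu.thetaEnvTower τ hC hS).PiYdd → (Cu.thetaEnvTower τ hC hS).mu M)
    (hη : ∀ M, η M ∈ (Cu.thetaEnvTower τ hC hS).thetaCocycles M)
    (hηc : ∀ (M M' : Es) (hd : (M : ℕ+) ∣ M'), (Cu.thetaEnvTower τ hC hS).red M M' hd ∘ η M' = η M)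
    (hpin : ∀ M : Es, (T.atLevel M).ThetaSectionCompat (HF M) ((Cu.thetaEnvTower τ hC hS).level M) ι (m M) hι (η M))
    -- … the étale data on the tower: `(γ, γ_μ)` with F-0652's conclusion SHAPE, glue, translation-freeness, separation across levels …
    (γ : (Cu.thetaEnvTower τ hC hS).PiX ≃ₜ* (Cu.thetaEnvTower τ hC hS).PiX)
    (hγ : (Cu.thetaEnvTower τ hC hS).PiYdd.map γ.toMulEquiv.toMonoidHom = (Cu.thetaEnvTower τ hC hS).PiYdd)
    (hγ' : ∀ x : (Cu.thetaEnvTower τ hC hS).PiX, x ∈ (Cu.thetaEnvTower τ hC hS).PiYdd → γ x ∈ (Cu.thetaEnvTower τ hC hS).PiYdd)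
    (γμ : ∀ M : Es, (Cu.thetaEnvTower τ hC hS).mu M ≃* (Cu.thetaEnvTower τ hC hS).mu M)
    (hstd : ∃ cf : ∀ M : Es, (Cu.thetaEnvTower τ hC hS).G → (Cu.thetaEnvTower τ hC hS).mu M,
      (∀ M, CycEnvelope.IsEnvCocycle (MonoidHom.id _) ((Cu.thetaEnvTower τ hC hS).chi M) (cf M)) ∧
      (∀ M, IsLocallyConstant (cf M ∘ (Cu.thetaEnvTower τ hC hS).aug)) ∧
      (∀ (M M' : Es) (hd : (M : ℕ+) ∣ M'), (Cu.thetaEnvTower τ hC hS).red M M' hd ∘ cf M' = cf M) ∧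
      (∀ M, (Cu.thetaEnvTower τ hC hS).pullbackCocycle M γ hγ (γμ M) '' (Cu.thetaEnvTower τ hC hS).thetaCocycles M =
        (fun η => η * (cf M ∘ (Cu.thetaEnvTower τ hC hS).aug ∘ (Cu.thetaEnvTower τ hC hS).PiYdd.subtype)) ''
          (Cu.thetaEnvTower τ hC hS).thetaCocycles M) ∧
      ∀ M : Es, ∃ d : (Cu.thetaEnvTower τ hC hS).mu M, ∀ g : (Cu.thetaEnvTower τ hC hS).G,
        cf M g ^ T.l = CycEnvelope.coboundary (MonoidHom.id _) ((Cu.thetaEnvTower τ hC hS).chi M) d g)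
    (hγμχ : ∀ (M : Es) (x : (Cu.thetaEnvTower τ hC hS).PiX) (tt : (Cu.thetaEnvTower τ hC hS).mu M),
      γμ M ((Cu.thetaEnvTower τ hC hS).chi M ((Cu.thetaEnvTower τ hC hS).aug x) tt) =
        (Cu.thetaEnvTower τ hC hS).chi M ((Cu.thetaEnvTower τ hC hS).aug (γ x)) (γμ M tt))
    (hγμred : ∀ (M M' : Es) (hd : (M : ℕ+) ∣ M') (tt : (Cu.thetaEnvTower τ hC hS).mu M'),
      (Cu.thetaEnvTower τ hC hS).red M M' hd (γμ M' tt) = γμ M ((Cu.thetaEnvTower τ hC hS).red M M' hd tt))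
    (haug : ∀ x y : (Cu.thetaEnvTower τ hC hS).PiX, (Cu.thetaEnvTower τ hC hS).aug x = (Cu.thetaEnvTower τ hC hS).aug y →
      (Cu.thetaEnvTower τ hC hS).aug (γ x) = (Cu.thetaEnvTower τ hC hS).aug (γ y))
    (hinfη : ∀ (M : Es) (k k' : (Cu.thetaEnvTower τ hC hS).PiYdd), (Cu.thetaEnvTower τ hC hS).aug k = (Cu.thetaEnvTower τ hC hS).aug k' →
      (η M k)⁻¹ * γμ M (η M ⟨γ.symm k, (Cu.thetaEnvTower τ hC hS).symm_apply_mem_PiYdd_of_map_eq γ hγ k k.2⟩) =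
        (η M k')⁻¹ * γμ M (η M ⟨γ.symm k', (Cu.thetaEnvTower τ hC hS).symm_apply_mem_PiYdd_of_map_eq γ hγ k' k'.2⟩))
    (hsep : ∀ η' : ∀ M : Es, (Cu.thetaEnvTower τ hC hS).PiYdd → (Cu.thetaEnvTower τ hC hS).mu M,
      (∀ M, η' M ∈ (Cu.thetaEnvTower τ hC hS).thetaCocycles M) →
      (∀ (M M' : Es) (hd : (M : ℕ+) ∣ M'), (Cu.thetaEnvTower τ hC hS).red M M' hd ∘ η' M' = η' M) →
      (∀ (M : Es) (k k' : (Cu.thetaEnvTower τ hC hS).PiYdd), (Cu.thetaEnvTower τ hC hS).aug k = (Cu.thetaEnvTower τ hC hS).aug k' →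
        η' M k * (η M k)⁻¹ = η' M k' * (η M k')⁻¹) →
      ∀ M : Es, ∃ d : (Cu.thetaEnvTower τ hC hS).mu M, ∀ k : (Cu.thetaEnvTower τ hC hS).PiYdd,
        (η' M k * (η M k)⁻¹) ^ 2 =
          CycEnvelope.coboundary ((Cu.thetaEnvTower τ hC hS).aug.comp (Cu.thetaEnvTower τ hC hS).PiYdd.subtype)
            ((Cu.thetaEnvTower τ hC hS).chi M) d k)
    -- … and Thm. 5.6 at each family member (base shadow `θ` with its laws, (K4m) at `γ_μ`), quantified EXACTLY like `htorsfam` was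
    (hK4fam : ∀ (α₁ : h44.Ψ.functor.obj (T.AN 1) ≅ T.AN 1) (β₁ : h44.Ψ.functor.obj (T.BN 1) ≅ T.BN 1) (u₁ : Aut (T.BN 1))
      (hu₁ : u₁ ∈ (T.atLevel 1).units (T.BN 1)),
      α₁.inv ≫ h44.Ψ.functor.map (T.sCap 1) ≫ β₁.hom = T.sCap 1 →
      α₁.inv ≫ h44.Ψ.functor.map (T.sCup 1) ≫ β₁.hom = T.sCup 1 ≫ u₁.hom →
      ∀ c : T.Kˣ, (T.atLevel 1).unitsToBirat (T.BN 1) ⟨u₁, hu₁⟩ = T.constEmb 1 c →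
      ∀ N (hN : N ∈ Es), ∀ (a : h44.Ψ.functor.obj (T.AN N) ≅ T.AN N) (b : h44.Ψ.functor.obj (T.BN N) ≅ T.BN N) (w : Aut (T.BN N)),
        w ∈ (T.atLevel N).units (T.BN N) →
        a.inv ≫ h44.Ψ.functor.map (T.sCap N) ≫ b.hom = T.sCap N →
        a.inv ≫ h44.Ψ.functor.map (T.sCup N) ≫ b.hom = T.sCup N ≫ w.hom →
        a.inv ≫ h44.Ψ.functor.map (T.α (one_dvd_level N)) ≫ α₁.hom = T.α (one_dvd_level N) →
        b.inv ≫ h44.Ψ.functor.map (T.β (one_dvd_level N)) ≫ β₁.hom = T.β (one_dvd_level N) →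
          ∃ θb : Aut (T.pre.base.obj (T.BN N)) ≃* Aut (T.pre.base.obj (T.BN N)),
            (T.atLevel N).HB.map θb.toMonoidHom = (T.atLevel N).HB ∧
            (T.atLevel N).StrvTransport h44.Ψ a (Iso.refl _) θb ∧
            (∀ k : T.PiYdd, θb (T.ρ N k) = T.ρ N (ι.symm (γ (ι k)))) ∧
            ∀ x : (Cu.thetaEnvTower τ hC hS).mu ⟨N, hN⟩, (T.atLevel N).psiAut h44.Ψ b
                (((m ⟨N, hN⟩).symm x : (T.atLevel N).muTorsion (T.atLevel N).BN (T.atLevel N).N) : Aut (T.atLevel N).BN) =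
              (((m ⟨N, hN⟩).symm (γμ ⟨N, hN⟩ x) : (T.atLevel N).muTorsion (T.atLevel N).BN (T.atLevel N).N) :
                Aut (T.atLevel N).BN)) :
    T.ThetaRootPreservedAll h44.Ψ := by
  refine thetaRootPreservedAll_ofThetaSettingYddFamily_final_v6_treeMonoidVocab_of_cor218_i Cu τ hC hS h Q R K' hX₀ t c₀ hc₀ ht hinvc hinvp α β
    comm_sCap comm_sCup isIsometry_α degFr_α isIsometry_β degFr_β baseFrob_α h44 ψ hpull hii h3 h4b h8 h15a h15 D T hT hgc cnst G ecn hP34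
    hF hαover hcharAN hdivA μ' h15iii L h218i hL h58N hK ?_
  intro α₁ β₁ u₁ hu₁ h₁ h₂ c hc N hN a b w hw hTa hTb hΨa hΨb
  -- the member's transport equations in the `(e, D_c, D_p) := (refl, 1, w)` shape of p458762 / p473560 (as in p445072)
  have hTr : a.inv ≫ h44.Ψ.functor.map (T.sCap N) ≫ b.hom = (Iso.refl (T.AN N)).hom ≫ T.sCap N ≫ (1 : Aut (T.BN N)).hom := by
    rw [hTa, Iso.refl_hom, Category.id_comp]
    show T.sCap N = T.sCap N ≫ (Iso.refl (T.BN N)).hom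
    rw [Iso.refl_hom, Category.comp_id]
  have hTr' : a.inv ≫ h44.Ψ.functor.map (T.sCup N) ≫ b.hom = (Iso.refl (T.AN N)).hom ≫ T.sCup N ≫ w.hom := by
    rw [hTb, Iso.refl_hom, Category.id_comp]
  -- Thm. 5.6 at the member (base shadow + (K4m)), then the étale instantiation (p478416); `Exists.elim` keeps the unifier cheap
  exact (hK4fam α₁ β₁ u₁ hu₁ h₁ h₂ c hc N hN a b w hw hTa hTb hΨa hΨb).elim fun θb hθ =>
    T.kummerTorsion_of_etaleTower h44.Ψ (Cu.thetaEnvTower τ hC hS) ι hι m hχ HF η hη hηc hpin γ hγ hγ' γμ hstd hγμχ hγμred haug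
      hinfη hsep hN a b (Iso.refl _) w θb hθ.1 hTr hTr' hθ.2.1 hw hθ.2.2.1 hθ.2.2.2

end CanonicalV6E

end ThetaFrobenioidTower

end Literature.AnabelianGeometry.EtaleTheta

end
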